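import Literature.Geometry.Lorentzian.ChartMetricCoord
import Literature.Geometry.Lorentzian.KerrSchildCoord
import HarnessLib

/-!
# Crux `ChannelsResolveTameDevelopmentsR` (stmt-FinalStateConjecture-14075), line
# `trapped-set-observability-analyticity` — stub `stub_trappedSetObservability` (S4', reshaped):
# the line's `boxAt` IS the tree's coordinate d'Alembertian `MetricCoord.lapAt`, hence the honest
# `□_g` of every chart metric with those components

The two-sided concentration law of stub S4' (`TwoSidedConcentrationLawK a r₀ G`) is a statement
about solutions of `boxAt G u = 0`, where the line's Defs file (p110780) defines
`boxAt G u x := MetricCoord.mtrAt G x (D²u(x)) − Du(x)(∑_β MetricCoord.chrAt G x (♯_G dx^β) ∂_β)`.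
Wave 1 audited on paper (A4) that this is the honest `□_G = g^{μν}(∂_μ∂_ν − Γ^λ_{μν}∂_λ)` in ANY
chart.  This file kernel-checks it, with the body of `boxAt` written verbatim (unfolded):

* `boxAt_eq_lapAt` — for ALL `G, u, x` (pure linear algebra, no hypothesis): the body of
  `boxAt G u x` equals `MetricCoord.lapAt G u x = tr_G (Hess_G u)(x)`, the coordinate
  Laplace–Beltrami / d'Alembert operator of `CoordScalarCurvatureEvolution.lean`
  (`lapAt_eq_sum`: `∑ g^{kl}(∂_k∂_l u − Du(Γ(∂_k, ∂_l)))`), through `♯_G dx^β = ∑_α g^{αβ} ∂_α`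
  (`sharpAt_dx_eq_sum`);
* `dalembertian_eq_boxAt` — hence, by the tree's link theorem `OpensChart.dalembertian_eq_lapAt`
  (`ChartMetricCoord.lean`), for every smooth pseudo-Riemannian metric `g` on an open `U ⊆ E4`
  with components `G` and every function with a `C²` representative, the ABSTRACT d'Alembertian
  `g.dalembertian f x` (`LeviCivita.lean`, Levi-Civita connection) IS `boxAt G Φ x`.

So every identity the tree proves for `lapAt` / `g.dalembertian` (locality, linearity, the
divergence form `|g|^{-1/2}∂_μ(|g|^{1/2}g^{μν}∂_ν)` of `LaplaceBeltramiChartForm.lean`, the Kerr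
chart formula `Kerr.dalembertian_eq_sum`) is available to the solutions the law quantifies over —
the entry point of the general forward energy estimate on the cylinder (the class-wide first rung,
still missing) and of the Kerr rung.  §3: the registered sub-goal `stub_boxAtEqLapAt`.
-/

set_option linter.dupNamespace false

noncomputable section

namespace Summit.FinalStateConjecture.FinalStateConjecture.Theorems.TrappedSet

open Literature.Geometry.Lorentzian
open scoped Manifold ContDiff Topology BigOperators
open Filter Set Function TopologicalSpace

/-- The dual-basis functional of the coordinate basis of `E4` is the coordinate covector:
`coordCLM (basisFun) β = dx^β`. [folklore] -/
theorem coordCLM_basisFun (β : Fin 4) :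
    MetricCoord.coordCLM (EuclideanSpace.basisFun (Fin 4) ℝ).toBasis β = E4.dx β := by
  ext v
  rw [MetricCoord.coordCLM_apply, Kerr.coord_basisFun]
  rfl

/-- **Index raising in coordinates**: `♯_G dx^β = ∑_α g^{αβ} ∂_α` (any components `G`, any point;
`g^{αβ} = MetricCoord.ginv` in the coordinate basis). [cite: ONeill1983, Ch. 3, p. 60] -/
theorem sharpAt_dx_eq_sum (G : E4 → E4 →L[ℝ] E4 →L[ℝ] ℝ) (x : E4) (β : Fin 4) :
    MetricCoord.sharpAt G x (E4.dx β) =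
      ∑ α, MetricCoord.ginv G (EuclideanSpace.basisFun (Fin 4) ℝ).toBasis x α β •
        E4.basisVector α := by
  conv_lhs => rw [Kerr.eq_sum_basisVector (MetricCoord.sharpAt G x (E4.dx β))]
  refine Finset.sum_congr rfl fun α _ ↦ ?_
  rw [MetricCoord.ginv, coordCLM_basisFun, Kerr.coord_basisFun]

/-- **The line's `boxAt` is the tree's `lapAt`.** For ALL components `G`, functions `u` and points
`x` (no invertibility, symmetry or regularity needed — it is linear algebra):
`tr_G D²u(x) − Du(x)(∑_β Γ_G(♯dx^β, ∂_β)) = tr_G (Hess_G u)(x) = MetricCoord.lapAt G u x`, the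
coordinate Laplace–Beltrami / d'Alembert operator `g^{μν}(∂_μ∂_ν u − Γ^λ_{μν} ∂_λ u)` of
`CoordScalarCurvatureEvolution.lean` (left side = the body of the line's `boxAt G u x`, verbatim).
[cite: ONeill1983, Ch. 3, Def. 3.50] -/
theorem boxAt_eq_lapAt (G : E4 → E4 →L[ℝ] E4 →L[ℝ] ℝ) (u : E4 → ℝ) (x : E4) :
    MetricCoord.mtrAt G x (fderiv ℝ (fderiv ℝ u) x) -
        fderiv ℝ u x (∑ β : Fin 4, MetricCoord.chrAt G x (MetricCoord.sharpAt G x (E4.dx β))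
          (E4.basisVector β)) =
      MetricCoord.lapAt G u x := by
  set b := (EuclideanSpace.basisFun (Fin 4) ℝ).toBasis with hb
  have hbv : ∀ μ, b μ = E4.basisVector μ := fun μ ↦ by
    simp [hb, OrthonormalBasis.coe_toBasis, EuclideanSpace.basisFun_apply]
  rw [MetricCoord.lapAt_eq_sum G b, MetricCoord.mtrAt_eq_sum b]
  simp only [mul_sub, Finset.sum_sub_distrib, hbv]
  congr 1
  -- the Christoffel term: `Du(∑_β Γ(♯dx^β, ∂_β)) = ∑_α ∑_β g^{αβ} Du(Γ(∂_α, ∂_β))`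
  rw [map_sum, Finset.sum_comm]
  refine Finset.sum_congr rfl fun β _ ↦ ?_
  rw [sharpAt_dx_eq_sum, map_sum, sum_apply, map_sum]
  refine Finset.sum_congr rfl fun α _ ↦ ?_
  rw [map_smul, smul_apply, map_smul, smul_eq_mul]

/-- **Hence `boxAt` is the honest `□_g`.** For every smooth pseudo-Riemannian metric `g` on an
open set `U ⊆ E4` with components `G` (`g.val y = G y`), every point `x ∈ U` and every function
`f` on `U` with a representative `Φ` of class `C²` at `x`: the abstract d'Alembertian
`g.dalembertian f x` (`LeviCivita.lean`: `tr_g Hess_g f`, Levi-Civita connection) equals the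
line's `boxAt G Φ x` (body verbatim) — in ANY chart, harmonic or not
(`OpensChart.dalembertian_eq_lapAt` + `boxAt_eq_lapAt`). [cite: ONeill1983, Ch. 3, Def. 3.50] -/
theorem dalembertian_eq_boxAt {U : Opens E4}
    {g : PseudoRiemannianMetric 𝓘(ℝ, E4) ∞ E4 (TangentSpace 𝓘(ℝ, E4) : U → Type _)}
    [g.HasLeviCivita] {G : E4 → E4 →L[ℝ] E4 →L[ℝ] ℝ} (hG : ∀ y : U, g.val y = G y) (x : U)
    {f : U → ℝ} {Φ : E4 → ℝ} (hf : ∀ y : U, f y = Φ y) (hΦ : ContDiffAt ℝ 2 Φ x) :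
    g.dalembertian f x =
      MetricCoord.mtrAt G x (fderiv ℝ (fderiv ℝ Φ) x) -
        fderiv ℝ Φ x (∑ β : Fin 4, MetricCoord.chrAt G x (MetricCoord.sharpAt G x (E4.dx β))
          (E4.basisVector β)) := by
  rw [OpensChart.dalembertian_eq_lapAt hG x hf hΦ, boxAt_eq_lapAt]


/-! ## §3 The registered sub-goal of `stub_trappedSetObservability` (S4 v2) -/

/-- Registered sub-goal `stub_boxAtEqLapAt` of `stub_trappedSetObservability` (S4 v2): **the body of
the line's `boxAt G u x` is `MetricCoord.lapAt G u x`, for all `G, u, x`.**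
[cite: ONeill1983, Ch. 3, Def. 3.50] -/
theorem stub_boxAtEqLapAt :
    ∀ (G : E4 → E4 →L[ℝ] E4 →L[ℝ] ℝ) (u : E4 → ℝ) (x : E4), MetricCoord.mtrAt G x (fderiv ℝ (fderiv ℝ u) x) - fderiv ℝ u x (∑ β : Fin 4, MetricCoord.chrAt G x (MetricCoord.sharpAt G x (E4.dx β)) (E4.basisVector β)) = MetricCoord.lapAt G u x :=
  boxAt_eq_lapAt

end Summit.FinalStateConjecture.FinalStateConjecture.Theorems.TrappedSet

end
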